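import Summits.NavierStokesRegularity.NavierStokesRegularity.Theorems.PerpetualPumpThesisBesovDuhamelBoundBridge
import Literature.Analysis.FluidPDE.TaoAveragedEulerFormBound

/-!
# Stub `besovDuhamelBound` for `PerpetualPump.Thesis`, part III: the trilinear Parseval identity
# `∫∫ â(ξ₁) b̂(ξ₂) γ(-ξ₁-ξ₂) = ∫ a b 𝓕⁻¹γ`

Support file (part 3 of the stub `besovDuhamelBound` of line `SketchIdeator2`, crux
stmt-NavierStokesRegularity-1832). Tao's Euler trilinear form is written on the Fourier side,
`⟨B(u,v), w⟩ = -πi ∫∫ Λ_{ξ₁,ξ₂,ξ₃}(û(ξ₁), v̂(ξ₂), ŵ(ξ₃)) dξ₁dξ₂` (T. Tao, J. Amer. Math. Soc. 29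
(2016), (1.3)–(1.4); tree `eulerForm`), which cannot see `L^∞` norms; the Besov–Duhamel estimate
of line `SketchIdeator2` needs its physical-space form. The dictionary is the **trilinear Parseval
identity** `∫∫ â_j(ξ₁) b̂_l(ξ₂) γ(-ξ₁-ξ₂) dξ₁dξ₂ = ∫ a_j b_l (𝓕⁻¹γ) dx` for `a, b ∈ L²(ℝ³; ℂ³)` with
`â ∈ L¹` and a Schwartz `γ` (`FA.integral_prod_fourierFn_mul_eq`), proved here in three steps:
Parseval in `ξ₂` for Tao's bilinear pairing of `b` with the field of transform `γ(· - ξ₁) e_l`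
(`FA.integral_schwartz_mul_fourierFn_eq`), the multiplication formula `∫ 𝓕⁻¹f · g = ∫ f · 𝓕⁻¹g`
in `ξ₁` (`FA.integral_fourierInv_mul_eq_flip`), and Fourier inversion on `L² ∩ 𝓕L¹`
(`FA.coeFn_ae_eq_fourierInv_fourierFn`); the double integral converges absolutely
(`FA.integrable_prod_fourierFn_mul`: `‖â‖₁ ‖b̂‖₂ ‖γ‖₂`).

## References

* T. Tao, J. Amer. Math. Soc. 29 (2016), 601–674, §1.1 (1.3)–(1.4) and p. 3.
* H. Bahouri, J.-Y. Chemin, R. Danchin, *Fourier Analysis and Nonlinear PDE* (2011), §1.2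
  (Fourier transform on `L¹ ∩ L²`, multiplication formula).
-/

noncomputable section

open MeasureTheory Filter Topology FourierTransform Real Complex
open scoped SchwartzMap ENNReal NNReal ComplexConjugate RealInnerProductSpace FourierTransform

set_option linter.dupNamespace false

namespace Summit.NavierStokesRegularity.NavierStokesRegularity.Theorems.PerpetualPumpThesis.FA

open Literature.Analysis.FunctionSpaces Literature.Analysis.FluidPDE
  Literature.Analysis.FluidPDE.Tao2016

/-! ### Fourier calculus on `L¹(ℝ³)` -/

/-- **The multiplication formula for `𝓕⁻¹`**: `∫ 𝓕⁻¹f · g = ∫ f · 𝓕⁻¹g` for integrable `f, g`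
(Mathlib's `VectorFourier.integral_fourierIntegral_smul_eq_flip` for the phase `-⟪·,·⟫`). -/
theorem integral_fourierInv_mul_eq_flip {f g : EuclideanSpace ℝ (Fin 3) → ℂ}
    (hf : Integrable f) (hg : Integrable g) :
    ∫ ξ, 𝓕⁻ f ξ * g ξ = ∫ x, f x * 𝓕⁻ g x := by
  have hL : Continuous fun p : EuclideanSpace ℝ (Fin 3) × EuclideanSpace ℝ (Fin 3) =>
      (-innerₗ (EuclideanSpace ℝ (Fin 3))) p.1 p.2 := by
    simp only [LinearMap.neg_apply, innerₗ_apply_apply]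
    fun_prop
  have h := VectorFourier.integral_fourierIntegral_smul_eq_flip (μ := volume) (ν := volume)
    (L := -innerₗ (EuclideanSpace ℝ (Fin 3))) (f := f) (g := g) Real.continuous_fourierChar hL hf hg
  have hflip : (-innerₗ (EuclideanSpace ℝ (Fin 3))).flip = -innerₗ (EuclideanSpace ℝ (Fin 3)) := by
    ext x y
    simp [real_inner_comm]
  rw [hflip] at h
  have e : ∀ (φ : EuclideanSpace ℝ (Fin 3) → ℂ) (ξ : EuclideanSpace ℝ (Fin 3)),
      𝓕⁻ φ ξ = VectorFourier.fourierIntegral 𝐞 volume (-innerₗ (EuclideanSpace ℝ (Fin 3))) φ ξ :=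
    fun φ ξ => rfl
  simp only [e]
  simpa only [smul_eq_mul] using h

/-- **`𝓕⁻¹` of a translate**: `𝓕⁻¹[g(· - v)](x) = e^{2πi⟪v,x⟫} 𝓕⁻¹g(x)`. -/
theorem fourierInv_comp_sub_right (g : EuclideanSpace ℝ (Fin 3) → ℂ) (v x : EuclideanSpace ℝ (Fin 3)) :
    𝓕⁻ (fun η => g (η - v)) x = (𝐞 ⟪v, x⟫ : ℂ) * 𝓕⁻ g x := by
  simp only [Real.fourierInv_eq, Circle.smul_def, smul_eq_mul]
  rw [← integral_add_right_eq_self (fun η : EuclideanSpace ℝ (Fin 3) => (𝐞 ⟪η, x⟫ : ℂ) * g (η - v)) v,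
    ← integral_const_mul]
  refine integral_congr_ae (ae_of_all _ fun η => ?_)
  simp only [add_sub_cancel_right, inner_add_left, AddChar.map_add_eq_mul, Circle.coe_mul]
  ring

/-- `(c • x) j = c x_j` on `ℂ³`, for the phase factors of the Fourier integrals. -/
theorem circle_smul_apply (c : Circle) (x : EuclideanSpace ℂ (Fin 3)) (j : Fin 3) :
    (c • x) j = (c : ℂ) * x j := by
  rw [Circle.smul_def, PiLp.smul_apply, smul_eq_mul]

/-- A coordinate of a vector Fourier integral is the Fourier integral of the coordinate. -/
theorem fourierInv_apply_coord {f : EuclideanSpace ℝ (Fin 3) → EuclideanSpace ℂ (Fin 3)}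
    (hf : Integrable f) (x : EuclideanSpace ℝ (Fin 3)) (j : Fin 3) :
    𝓕⁻ f x j = 𝓕⁻ (fun ξ => f ξ j) x := by
  simp only [Real.fourierInv_eq]
  have hint : Integrable (fun v : EuclideanSpace ℝ (Fin 3) => 𝐞 ⟪v, x⟫ • f v) := by
    have h := (Real.fourierIntegral_convergent_iff (μ := volume) (f := f) (-x)).2 hf
    simpa only [inner_neg_right, neg_neg] using h
  have h := (EuclideanSpace.proj (𝕜 := ℂ) (ι := Fin 3) j).integral_comp_comm hint
  calc (∫ v, 𝐞 ⟪v, x⟫ • f v) j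
      = EuclideanSpace.proj (𝕜 := ℂ) j (∫ v, 𝐞 ⟪v, x⟫ • f v) := rfl
    _ = ∫ v, EuclideanSpace.proj (𝕜 := ℂ) j (𝐞 ⟪v, x⟫ • f v) := h.symm
    _ = ∫ v, 𝐞 ⟪v, x⟫ • f v j := integral_congr_ae (ae_of_all _ fun v => by
          change (𝐞 ⟪v, x⟫ • f v) j = 𝐞 ⟪v, x⟫ • f v j
          rw [circle_smul_apply, Circle.smul_def, smul_eq_mul])

/-- **Fourier inversion on `L² ∩ 𝓕L¹`**: an `L²` field whose Fourier transform is integrable is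
a.e. the inverse Fourier integral of its transform. -/
theorem coeFn_ae_eq_fourierInv_fourierFn (a : L2C) (ha : Integrable (fourierFn a)) :
    ((a : L2C) : EuclideanSpace ℝ (Fin 3) → EuclideanSpace ℂ (Fin 3)) =ᵐ[volume]
      𝓕⁻ (fourierFn a) := by
  have h2 : MemLp (fourierFn a) 2 (volume : Measure (EuclideanSpace ℝ (Fin 3))) := Lp.memLp _
  have key := SobolevEmbeddingHalf.fourierInv_toLp_ae_eq_fourierIntegralInv ha h2
  have htoLp : h2.toLp (fourierFn a) = (𝓕 a : L2C) := Lp.toLp_coeFn _ _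
  rw [htoLp, fourierInv_fourier_eq] at key
  exact key

/-- `a · (s e_l) = a_l s` on `ℂ³`. -/
theorem cdot_smul_single_right (a : EuclideanSpace ℂ (Fin 3)) (s : ℂ) (l : Fin 3) :
    cdot a (s • EuclideanSpace.single l (1 : ℂ)) = a l * s := by
  simp only [cdot, PiLp.smul_apply, PiLp.single_apply, smul_eq_mul, mul_ite, mul_one,
    mul_zero]
  rw [Finset.sum_eq_single l (fun j _ hj => by simp [hj]) (by simp)]
  simp

/-- `(s e_l) · a = s a_l` on `ℂ³`. -/
theorem cdot_smul_single_left (a : EuclideanSpace ℂ (Fin 3)) (s : ℂ) (l : Fin 3) :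
    cdot (s • EuclideanSpace.single l (1 : ℂ)) a = s * a l := by
  simp only [cdot, PiLp.smul_apply, PiLp.single_apply, smul_eq_mul, mul_ite, mul_one,
    mul_zero, ite_mul, zero_mul]
  rw [Finset.sum_eq_single l (fun j _ hj => by simp [hj]) (by simp)]
  simp

/-! ### Parseval in the inner variable against a translated test field -/

/-- **Step 1 of the trilinear identity**: for `b ∈ L²(ℝ³; ℂ³)`, a Schwartz `γ` and `ξ₁ ∈ ℝ³`,
`∫ γ(-ξ-ξ₁) b̂_l(ξ) dξ = ∫ b_l(x) e^{2πi⟪ξ₁,x⟫} 𝓕⁻¹γ(x) dx` (Parseval for the bilinear pairing of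
`b` with the field whose transform is `γ(· - ξ₁) e_l`). -/
theorem integral_schwartz_mul_fourierFn_eq (b : L2C) (γ : 𝓢(EuclideanSpace ℝ (Fin 3), ℂ))
    (ξ₁ : EuclideanSpace ℝ (Fin 3)) (l : Fin 3) :
    ∫ ξ, γ (-ξ - ξ₁) * fourierFn b ξ l =
      ∫ x, ((b : L2C) : EuclideanSpace ℝ (Fin 3) → EuclideanSpace ℂ (Fin 3)) x l *
        ((𝐞 ⟪ξ₁, x⟫ : ℂ) * 𝓕⁻ (⇑γ) x) := by
  -- the test field on the Fourier side
  set Wf : EuclideanSpace ℝ (Fin 3) → EuclideanSpace ℂ (Fin 3) :=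
    fun η => γ (η - ξ₁) • EuclideanSpace.single l (1 : ℂ) with hWf
  have hγt : Integrable (fun η : EuclideanSpace ℝ (Fin 3) => γ (η - ξ₁)) :=
    γ.integrable.comp_sub_right ξ₁
  have hγt2 : MemLp (fun η : EuclideanSpace ℝ (Fin 3) => γ (η - ξ₁)) 2
      (volume : Measure (EuclideanSpace ℝ (Fin 3))) :=
    (γ.memLp 2 volume).comp_measurePreserving (measurePreserving_sub_right volume ξ₁)
  have hW1 : Integrable Wf := hγt.smul_const _
  have hW2 : MemLp Wf 2 (volume : Measure (EuclideanSpace ℝ (Fin 3))) :=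
    hγt2.of_le_mul (c := ‖EuclideanSpace.single l (1 : ℂ)‖) (hγt.1.smul_const _)
      (ae_of_all _ fun η => by rw [hWf, norm_smul, mul_comm])
  set W : L2C := (𝓕⁻ (hW2.toLp Wf) : L2C) with hW
  -- its Fourier transform and its values
  have hFW : fourierFn W =ᵐ[volume] Wf := by
    unfold fourierFn
    rw [hW, fourier_fourierInv_eq]
    exact hW2.coeFn_toLp
  have hWx : ((W : L2C) : EuclideanSpace ℝ (Fin 3) → EuclideanSpace ℂ (Fin 3)) =ᵐ[volume]
      fun x => ((𝐞 ⟪ξ₁, x⟫ : ℂ) * 𝓕⁻ (⇑γ) x) • EuclideanSpace.single l (1 : ℂ) := by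
    filter_upwards [SobolevEmbeddingHalf.fourierInv_toLp_ae_eq_fourierIntegralInv hW1 hW2] with x hx
    rw [← hW] at hx
    rw [hx, ← fourierInv_comp_sub_right]
    simp only [hWf, Real.fourierInv_eq, Circle.smul_def, smul_smul]
    rw [integral_smul_const]
    simp only [smul_eq_mul]
  -- the pairing `⟨b, W⟩` computed on both sides
  have h1 : pairing b W = ∫ ξ, γ (-ξ - ξ₁) * fourierFn b ξ l := by
    rw [pairing_eq_integral_cdot_fourierFn]
    refine integral_congr_ae ?_
    have hneg := (Measure.measurePreserving_neg (volume : Measure (EuclideanSpace ℝ (Fin 3)))).quasiMeasurePreserving.ae_eq hFW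
    filter_upwards [hneg] with ξ hξ
    simp only [Function.comp_apply] at hξ
    rw [hξ, hWf]
    simp only
    rw [cdot_smul_single_left, show -ξ - ξ₁ = -ξ - ξ₁ from rfl]
  have h2 : pairing b W = ∫ x, ((b : L2C) : EuclideanSpace ℝ (Fin 3) → EuclideanSpace ℂ (Fin 3)) x l *
      ((𝐞 ⟪ξ₁, x⟫ : ℂ) * 𝓕⁻ (⇑γ) x) := by
    unfold pairing
    refine integral_congr_ae ?_
    filter_upwards [hWx] with x hx
    rw [hx, cdot_smul_single_right]
  rw [← h1, h2]

/-! ### The trilinear Parseval identity -/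

/-- Monotonicity of `‖·‖ₑ` from a norm inequality between a scalar and a vector (coordinates
versus the Euclidean norm). -/
theorem enorm_le_enorm_of_norm_le {a : ℂ} {v : EuclideanSpace ℂ (Fin 3)} (h : ‖a‖ ≤ ‖v‖) :
    ‖a‖ₑ ≤ ‖v‖ₑ := by
  rw [← ofReal_norm, ← ofReal_norm]
  exact ENNReal.ofReal_le_ofReal h

/-- **Cauchy–Schwarz in the inner variable**, scalar form: `∫ A(ξ) |γ(c - ξ)| dξ ≤ ‖A‖₂ ‖γ‖₂`. -/
theorem lintegral_mul_enorm_comp_sub_le' {A : EuclideanSpace ℝ (Fin 3) → ℝ≥0∞}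
    {γ : EuclideanSpace ℝ (Fin 3) → ℂ} (hA : AEMeasurable A volume)
    (hγ : AEStronglyMeasurable γ volume) (c : EuclideanSpace ℝ (Fin 3)) :
    ∫⁻ ξ, A ξ * ‖γ (c - ξ)‖ₑ ≤
      (∫⁻ ξ, A ξ ^ 2) ^ (1 / 2 : ℝ) * (∫⁻ ξ, ‖γ ξ‖ₑ ^ 2) ^ (1 / 2 : ℝ) := by
  -- adapted from `lintegral_mul_enorm_comp_sub_le` (TaoAveragedEulerFormBound)
  have hmp : MeasurePreserving (fun ξ : EuclideanSpace ℝ (Fin 3) => c - ξ) volume volume :=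
    Measure.measurePreserving_sub_left volume c
  have hγ' : AEMeasurable (fun ξ => ‖γ (c - ξ)‖ₑ) volume :=
    (hγ.comp_quasiMeasurePreserving hmp.quasiMeasurePreserving).enorm
  calc ∫⁻ ξ, A ξ * ‖γ (c - ξ)‖ₑ
      ≤ (∫⁻ ξ, A ξ ^ (2 : ℝ)) ^ (1 / (2 : ℝ)) * (∫⁻ ξ, ‖γ (c - ξ)‖ₑ ^ (2 : ℝ)) ^ (1 / (2 : ℝ)) :=
        ENNReal.lintegral_mul_le_Lp_mul_Lq volume Real.HolderConjugate.two_two hA hγ'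
    _ = (∫⁻ ξ, A ξ ^ 2) ^ (1 / 2 : ℝ) * (∫⁻ ξ, ‖γ ξ‖ₑ ^ 2) ^ (1 / 2 : ℝ) := by
        rw [lintegral_sub_left_eq_self (fun ξ => ‖γ ξ‖ₑ ^ (2 : ℝ)) c]
        simp only [ENNReal.rpow_two]

/-- **Integrability of the trilinear Fourier integrand**: for `a, b ∈ L²(ℝ³; ℂ³)` with `â ∈ L¹`
and a Schwartz `γ`, `(ξ₁, ξ₂) ↦ â_j(ξ₁) b̂_l(ξ₂) γ(-ξ₁-ξ₂)` is integrable on `ℝ⁶`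
(`∫ |â| · sup_{ξ₁} ∫ |b̂(ξ₂)| |γ(-ξ₁-ξ₂)| dξ₂ ≤ ‖â‖₁ ‖b̂‖₂ ‖γ‖₂`). -/
theorem integrable_prod_fourierFn_mul (a b : L2C) (ha : Integrable (fourierFn a))
    (γ : 𝓢(EuclideanSpace ℝ (Fin 3), ℂ)) (j l : Fin 3) :
    Integrable (fun p : EuclideanSpace ℝ (Fin 3) × EuclideanSpace ℝ (Fin 3) =>
      fourierFn a p.1 j * (fourierFn b p.2 l * γ (-p.1 - p.2)))
      ((volume : Measure (EuclideanSpace ℝ (Fin 3))).prod volume) := by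
  set μ : Measure (EuclideanSpace ℝ (Fin 3)) := volume with hμ
  have haj : AEStronglyMeasurable (fun ξ => fourierFn a ξ j) μ :=
    (EuclideanSpace.proj (𝕜 := ℂ) j).continuous.comp_aestronglyMeasurable (Lp.memLp (𝓕 a : L2C)).1
  have hbl : AEStronglyMeasurable (fun ξ => fourierFn b ξ l) μ :=
    (EuclideanSpace.proj (𝕜 := ℂ) l).continuous.comp_aestronglyMeasurable (Lp.memLp (𝓕 b : L2C)).1
  have hγm : AEStronglyMeasurable (⇑γ) μ := γ.continuous.aestronglyMeasurable
  have hmeas : AEStronglyMeasurable (fun p : EuclideanSpace ℝ (Fin 3) × EuclideanSpace ℝ (Fin 3) =>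
      fourierFn a p.1 j * (fourierFn b p.2 l * γ (-p.1 - p.2))) (μ.prod μ) :=
    (haj.comp_quasiMeasurePreserving Measure.quasiMeasurePreserving_fst).mul
      ((hbl.comp_quasiMeasurePreserving Measure.quasiMeasurePreserving_snd).mul
        (hγm.comp_quasiMeasurePreserving quasiMeasurePreserving_neg_fst_sub_snd))
  refine ⟨hmeas, ?_⟩
  -- the finite integral, by Tonelli and Cauchy–Schwarz inside
  have hA : AEMeasurable (fun p : EuclideanSpace ℝ (Fin 3) × EuclideanSpace ℝ (Fin 3) =>
      ‖fourierFn a p.1 j‖ₑ) (μ.prod μ) :=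
    (haj.comp_quasiMeasurePreserving Measure.quasiMeasurePreserving_fst).enorm
  have hB : AEMeasurable (fun p : EuclideanSpace ℝ (Fin 3) × EuclideanSpace ℝ (Fin 3) =>
      ‖fourierFn b p.2 l‖ₑ) (μ.prod μ) :=
    (hbl.comp_quasiMeasurePreserving Measure.quasiMeasurePreserving_snd).enorm
  have hC : AEMeasurable (fun p : EuclideanSpace ℝ (Fin 3) × EuclideanSpace ℝ (Fin 3) =>
      ‖γ (-p.1 - p.2)‖ₑ) (μ.prod μ) :=
    (hγm.comp_quasiMeasurePreserving quasiMeasurePreserving_neg_fst_sub_snd).enorm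
  have hB2fin : (∫⁻ ξ, ‖fourierFn b ξ l‖ₑ ^ 2 ∂μ) ^ (1 / 2 : ℝ) < ⊤ := by
    have hb2 : MemLp (fun ξ => fourierFn b ξ l) 2 μ :=
      ((Lp.memLp (𝓕 b : L2C)).continuousLinearMap_comp (EuclideanSpace.proj (𝕜 := ℂ) l))
    have := hb2.eLpNorm_lt_top
    rw [eLpNorm_eq_lintegral_rpow_enorm_toReal two_ne_zero ENNReal.ofNat_ne_top,
      ENNReal.toReal_ofNat] at this
    simpa only [ENNReal.rpow_two] using this
  have hG2fin : (∫⁻ ξ, ‖γ ξ‖ₑ ^ 2 ∂μ) ^ (1 / 2 : ℝ) < ⊤ := by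
    have := (γ.memLp 2 μ).eLpNorm_lt_top
    rw [eLpNorm_eq_lintegral_rpow_enorm_toReal two_ne_zero ENNReal.ofNat_ne_top,
      ENNReal.toReal_ofNat] at this
    simpa only [ENNReal.rpow_two] using this
  set B2 : ℝ≥0∞ := (∫⁻ ξ, ‖fourierFn b ξ l‖ₑ ^ 2 ∂μ) ^ (1 / 2 : ℝ) with hB2
  set G2 : ℝ≥0∞ := (∫⁻ ξ, ‖γ ξ‖ₑ ^ 2 ∂μ) ^ (1 / 2 : ℝ) with hG2
  have hABC : AEMeasurable (fun p : EuclideanSpace ℝ (Fin 3) × EuclideanSpace ℝ (Fin 3) =>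
      ‖fourierFn a p.1 j‖ₑ * (‖fourierFn b p.2 l‖ₑ * ‖γ (-p.1 - p.2)‖ₑ)) (μ.prod μ) :=
    hA.mul (hB.mul hC)
  have hfin : ∫⁻ p, ‖fourierFn a p.1 j‖ₑ * (‖fourierFn b p.2 l‖ₑ * ‖γ (-p.1 - p.2)‖ₑ) ∂(μ.prod μ) ≤
      (∫⁻ ξ, ‖fourierFn a ξ j‖ₑ ∂μ) * (B2 * G2) := by
    rw [lintegral_prod _ hABC]
    calc ∫⁻ ξ₁, ∫⁻ ξ₂, ‖fourierFn a ξ₁ j‖ₑ * (‖fourierFn b ξ₂ l‖ₑ * ‖γ (-ξ₁ - ξ₂)‖ₑ) ∂μ ∂μ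
        = ∫⁻ ξ₁, ‖fourierFn a ξ₁ j‖ₑ * ∫⁻ ξ₂, ‖fourierFn b ξ₂ l‖ₑ * ‖γ (-ξ₁ - ξ₂)‖ₑ ∂μ ∂μ := by
          refine lintegral_congr fun ξ₁ => ?_
          rw [lintegral_const_mul' _ _ enorm_ne_top]
      _ ≤ ∫⁻ ξ₁, ‖fourierFn a ξ₁ j‖ₑ * (B2 * G2) ∂μ := by
          refine lintegral_mono fun ξ₁ => mul_le_mul' le_rfl ?_
          exact lintegral_mul_enorm_comp_sub_le' hbl.enorm hγm (-ξ₁)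
      _ = (∫⁻ ξ, ‖fourierFn a ξ j‖ₑ ∂μ) * (B2 * G2) := lintegral_mul_const'' _ haj.enorm
  have hajfin : ∫⁻ ξ, ‖fourierFn a ξ j‖ₑ ∂μ < ⊤ := by
    refine lt_of_le_of_lt (lintegral_mono fun ξ => ?_) ha.2
    exact enorm_le_enorm_of_norm_le (PiLp.norm_apply_le (fourierFn a ξ) j) |>.trans le_rfl
  refine lt_of_le_of_lt ?_ (ENNReal.mul_lt_top hajfin (ENNReal.mul_lt_top hB2fin hG2fin))
  refine le_trans (lintegral_mono fun p => ?_) hfin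
  rw [enorm_mul, enorm_mul]

/-- **The trilinear Parseval identity**: for `a, b ∈ L²(ℝ³; ℂ³)` with `â ∈ L¹` and a Schwartz
`γ`, `∫∫ â_j(ξ₁) b̂_l(ξ₂) γ(-ξ₁-ξ₂) dξ₁ dξ₂ = ∫ a_j(x) b_l(x) 𝓕⁻¹γ(x) dx` (Parseval in `ξ₂`, the
multiplication formula in `ξ₁`, Fourier inversion for `a`). -/
theorem integral_prod_fourierFn_mul_eq (a b : L2C) (ha : Integrable (fourierFn a))
    (γ : 𝓢(EuclideanSpace ℝ (Fin 3), ℂ)) (j l : Fin 3) :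
    ∫ p : EuclideanSpace ℝ (Fin 3) × EuclideanSpace ℝ (Fin 3),
        fourierFn a p.1 j * (fourierFn b p.2 l * γ (-p.1 - p.2)) ∂(volume.prod volume) =
      ∫ x, ((a : L2C) : EuclideanSpace ℝ (Fin 3) → EuclideanSpace ℂ (Fin 3)) x j *
        (((b : L2C) : EuclideanSpace ℝ (Fin 3) → EuclideanSpace ℂ (Fin 3)) x l * 𝓕⁻ (⇑γ) x) := by
  rw [integral_prod _ (integrable_prod_fourierFn_mul a b ha γ j l)]
  -- the physical-space product `q = b_l · 𝓕⁻¹γ ∈ L¹`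
  set c : EuclideanSpace ℝ (Fin 3) → ℂ := 𝓕⁻ (⇑γ) with hc
  have hcS : c = ⇑(𝓕⁻ γ : 𝓢(EuclideanSpace ℝ (Fin 3), ℂ)) := by rw [hc, SchwartzMap.fourierInv_coe]
  set q : EuclideanSpace ℝ (Fin 3) → ℂ := fun x =>
    ((b : L2C) : EuclideanSpace ℝ (Fin 3) → EuclideanSpace ℂ (Fin 3)) x l * c x with hq
  have hbl2 : MemLp (fun x => ((b : L2C) : EuclideanSpace ℝ (Fin 3) → EuclideanSpace ℂ (Fin 3)) x l) 2
      (volume : Measure (EuclideanSpace ℝ (Fin 3))) :=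
    (Lp.memLp b).continuousLinearMap_comp (EuclideanSpace.proj (𝕜 := ℂ) l)
  have hc2 : MemLp c 2 (volume : Measure (EuclideanSpace ℝ (Fin 3))) := by
    rw [hcS]; exact (𝓕⁻ γ : 𝓢(EuclideanSpace ℝ (Fin 3), ℂ)).memLp 2 volume
  have hqi : Integrable q := by
    have := MemLp.mul (p := 2) (q := 2) (r := 1) hbl2 hc2
    rw [memLp_one_iff_integrable] at this
    refine this.congr (ae_of_all _ fun x => ?_)
    simp only [hq, Pi.mul_apply, mul_comm]
  have haj : Integrable (fun ξ => fourierFn a ξ j) :=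
    (EuclideanSpace.proj (𝕜 := ℂ) j).integrable_comp ha
  -- the inner integral is `𝓕⁻¹ q (ξ₁)`
  have hinner : ∀ ξ₁ : EuclideanSpace ℝ (Fin 3),
      ∫ ξ₂, fourierFn a ξ₁ j * (fourierFn b ξ₂ l * γ (-ξ₁ - ξ₂)) =
        𝓕⁻ q ξ₁ * fourierFn a ξ₁ j := by
    intro ξ₁
    rw [integral_const_mul, mul_comm]
    congr 1
    have h1 := integral_schwartz_mul_fourierFn_eq b γ ξ₁ l
    have hlhs : ∫ ξ₂, fourierFn b ξ₂ l * γ (-ξ₁ - ξ₂) = ∫ ξ, γ (-ξ - ξ₁) * fourierFn b ξ l := by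
      refine integral_congr_ae (ae_of_all _ fun ξ => ?_)
      dsimp only
      rw [mul_comm, show -ξ₁ - ξ = -ξ - ξ₁ by abel]
    rw [hlhs, h1, Real.fourierInv_eq]
    refine integral_congr_ae (ae_of_all _ fun x => ?_)
    simp only [hq, Circle.smul_def, smul_eq_mul, real_inner_comm ξ₁ x]
    ring
  simp_rw [hinner]
  rw [integral_fourierInv_mul_eq_flip hqi haj]
  -- Fourier inversion for `a`
  refine integral_congr_ae ?_
  filter_upwards [coeFn_ae_eq_fourierInv_fourierFn a ha] with x hx
  rw [← fourierInv_apply_coord ha, ← hx]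
  simp only [hq]
  ring

end Summit.NavierStokesRegularity.NavierStokesRegularity.Theorems.PerpetualPumpThesis.FA

namespace Summit.NavierStokesRegularity.NavierStokesRegularity.Theorems.PerpetualPumpThesis

open Literature.Analysis.FluidPDE Literature.Analysis.FluidPDE.Tao2016
open Literature.Analysis.FunctionSpaces

/-- **Part Parseval of stub `besovDuhamelBound` (registered sub-goal `stub_FA_Parseval`)**: the
trilinear Parseval identity `∫∫ â_j(ξ₁) b̂_l(ξ₂) γ(-ξ₁-ξ₂) dξ₁dξ₂ = ∫ a_j b_l 𝓕⁻¹γ dx` for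
`a, b ∈ L²(ℝ³; ℂ³)` with `â ∈ L¹` and a Schwartz `γ` — the dictionary between Tao's Fourier-side
Euler form (1.3) and physical-space products. -/
theorem stub_FA_Parseval : ∀ (a b : L2C), Integrable (fourierFn a) volume → ∀ (γ : 𝓢(EuclideanSpace ℝ (Fin 3), ℂ)) (j l : Fin 3), ∫ p : EuclideanSpace ℝ (Fin 3) × EuclideanSpace ℝ (Fin 3), fourierFn a p.1 j * (fourierFn b p.2 l * γ (-p.1 - p.2)) ∂((volume : Measure (EuclideanSpace ℝ (Fin 3))).prod volume) = ∫ x, ((a : L2C) : EuclideanSpace ℝ (Fin 3) → EuclideanSpace ℂ (Fin 3)) x j * (((b : L2C) : EuclideanSpace ℝ (Fin 3) → EuclideanSpace ℂ (Fin 3)) x l * FourierTransformInv.fourierInv (⇑γ) x) :=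
  fun a b ha γ j l => FA.integral_prod_fourierFn_mul_eq a b ha γ j l

end Summit.NavierStokesRegularity.NavierStokesRegularity.Theorems.PerpetualPumpThesis
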